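import Literature.Analysis.OperatorTheory.KernelCyclicPeeling
import HarnessLib

/-!
# Peeling cyclic path integrals with a DIFFERENT transfer kernel on every bond

Topic `Literature/Analysis/OperatorTheory`; companion of `KernelPathIntegralPeeling.lean` (open blocks, one
kernel `K`) and `KernelCyclicPeeling.lean` (cycles, one kernel `K`, one-site insertions).  Transfer-matrix
computations with OBSERVABLES INSERTED ON BONDS — the slab operators of a time-sliced lattice model, whose
kernel `X(y, y')` between two consecutive slice variables is not a multiple of the transfer kernel — need the
same identities for a cycle `V : Fin (1 + M + 1) → Y` whose `t`-th bond carries its own bounded measurable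
kernel `κ t` (an `ℕ`-indexed family, only `κ 0, …, κ (M+1)` are used):

* `integral_hetPathWeight_succ_eq` — one-step peeling of the open path weight
  `∏ᵢ κᵢ((u ∷ ζ)ᵢ, ζᵢ)` (Fubini along `Fin.cons`);
* `integral_hetPathWeight_eq_foldr` — peeling the first `j` of `n + j` sites gives the nested integral
  operators `Fin.foldr j (fun i f x ↦ ∫ κᵢ(x, y) f(y)) h`;
* `integral_cyclic_het_eq_foldr` (**main**) — the TRACE FORMULA for the cycle,
  `∫ ∏ₜ κₜ(V t, V (t+1)) dρ^{⊗(M+2)} = ∫ (Fin.foldr (M+1) (opᵢ) (κ_{M+1}(·, x)))(x) dρ(x)`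
  ("`Tr(𝕂₀ 𝕂₁ ⋯ 𝕂_{M+1})`" without operator traces);
* `integral_cyclic_insert_one`, `integral_cyclic_insert_two` — the two shapes used by second-moment
  (variance) estimates: one bond kernel `X` followed by `M + 1` copies of `K`
  (`= ∫∫ X(x,y) (κ_K^[M] K(·,x))(y)`), and `X`, `a` copies of `K`, `X'`, `b` copies of `K`
  (`= ∫∫ X(x,y) (κ_K^[a] (z ↦ ∫ X'(z,w) (κ_K^[b-1] K(·,x))(w)))(y)`);
* `integral_cyclic_het_merge` (appended) — MERGING two adjacent bonds: integrating out site `1` replaces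
  `κ₀, κ₁` by the composed kernel `κ₀ ∗ κ₁` (associativity of the transfer operators,
  `integral_kernel_mul_integral_kernel_mul`; with `measurable_bdd_kernel_op`, `measurable_bdd_foldr_op`,
  `measurable_bdd_kernel_conv`); iterated, it contracts a slab of consecutive bond insertions to one bond;
* `integral_cyclic_block_contract` (appended) — BLOCK CONTRACTION: a bounded measurable joint weight `Ψ` of
  `r + 2` consecutive sites integrates out to the bond kernel `X̂(u,u') = ∫ Ψ(u ∷ v :: u') dρ^{⊗r}(v)`
  between its end sites, leaving the one-insertion shape of `integral_cyclic_insert_one` (with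
  `measurable_finSnoc`, `measurePreserving_finSplit`, `finSplit_apply_fst/snd`);
* `integral_pi_mul_split` (appended) — `∫ a(g|_p) b(g|_{¬p}) dν^{⊗ι} = (∫ a)(∫ b)` (independent coordinate blocks);
* `integral_pi_comp_perm`, `integral_block_rev` (appended) — relabelling invariance of the product integrals and
  "the contracted kernel of the REVERSED slab weight is the transpose" (`X̂_{Ψ∘rev}(u,u') = X̂_Ψ(u',u)`).

Everything is PROVED, Mathlib + the two companion files only; no definitions (the pointwise operators
`(op κ f)(x) = ∫ κ(x, y) f(y) dρ(y)` are written out). [folklore]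
-/

noncomputable section

open MeasureTheory Filter Set Function

namespace Literature.Analysis.OperatorTheory

variable {Y : Type*} [MeasurableSpace Y] {ρ : Measure Y} [IsFiniteMeasure ρ]
  {κ : ℕ → Y → Y → ℝ} {C : ℝ}

/-! ### The open path weight with bond-dependent kernels -/

/-- Measurability of `(u, ζ) ↦ ∏ᵢ κ_{i+s}((u ∷ ζ)ᵢ, ζᵢ)`. [folklore] -/
theorem measurable_hetPathWeight (hκ : ∀ t, Measurable (uncurry (κ t))) (s M : ℕ) :
    Measurable fun p : Y × (Fin M → Y) =>
      ∏ i : Fin M, κ (i + s) ((Fin.cons p.1 p.2 : Fin (M + 1) → Y) (Fin.castSucc i)) (p.2 i) := by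
  refine Finset.measurable_prod _ fun i _ => ?_
  have h1 : Measurable fun p : Y × (Fin M → Y) => (Fin.cons p.1 p.2 : Fin (M + 1) → Y) (Fin.castSucc i) :=
    (measurable_pi_apply _).comp (measurable_finCons M)
  have h2 : Measurable fun p : Y × (Fin M → Y) => p.2 i := (measurable_pi_apply i).comp measurable_snd
  exact (hκ _).comp (h1.prodMk h2)

omit [MeasurableSpace Y] in
/-- The path weight is bounded by `C^M` when every `|κₜ| ≤ C`. [folklore] -/
theorem norm_hetPathWeight_le (hC : ∀ t x y, ‖κ t x y‖ ≤ C) (s M : ℕ) (u : Y) (ζ : Fin M → Y) :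
    ‖∏ i : Fin M, κ (i + s) ((Fin.cons u ζ : Fin (M + 1) → Y) (Fin.castSucc i)) (ζ i)‖ ≤ C ^ M := by
  calc ‖∏ i : Fin M, κ (i + s) ((Fin.cons u ζ : Fin (M + 1) → Y) (Fin.castSucc i)) (ζ i)‖
      ≤ ∏ i : Fin M, ‖κ (i + s) ((Fin.cons u ζ : Fin (M + 1) → Y) (Fin.castSucc i)) (ζ i)‖ :=
        Finset.norm_prod_le _ _
    _ ≤ ∏ _i : Fin M, C := Finset.prod_le_prod (fun i _ => norm_nonneg _) fun i _ => hC _ _ _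
    _ = C ^ M := by simp

/-- **One-step peeling with bond-dependent kernels.** For bounded measurable kernels `κₜ` on a finite
measure space, a block of `M + 1` sites with left boundary spin `u`, kernels `κ_s, κ_{s+1}, …` on its bonds
and a bounded measurable function `F` of the block,
`∫ (∏ᵢ κ_{i+s}((u∷ζ)ᵢ, ζᵢ)) F(ζ) dρ^{⊗(M+1)}(ζ) = ∫ κ_s(u,y) [∫ (∏ᵢ κ_{i+s+1}((y∷ζ')ᵢ, ζ'ᵢ)) F(y∷ζ') dρ^{⊗M}(ζ')] dρ(y)`.
[folklore] -/
theorem integral_hetPathWeight_succ_eq (hκ : ∀ t, Measurable (uncurry (κ t))) (hC : ∀ t x y, ‖κ t x y‖ ≤ C)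
    (s M : ℕ) (u : Y) {F : (Fin (M + 1) → Y) → ℝ} (hF : Measurable F) {B : ℝ} (hFb : ∀ ζ, ‖F ζ‖ ≤ B) :
    ∫ ζ : Fin (M + 1) → Y, (∏ i : Fin (M + 1),
        κ (i + s) ((Fin.cons u ζ : Fin (M + 2) → Y) (Fin.castSucc i)) (ζ i)) * F ζ ∂(Measure.pi fun _ => ρ) =
      ∫ y, κ s u y * ∫ ζ' : Fin M → Y, (∏ i : Fin M,
        κ (i + (s + 1)) ((Fin.cons y ζ' : Fin (M + 1) → Y) (Fin.castSucc i)) (ζ' i)) *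
          F (Fin.cons y ζ') ∂(Measure.pi fun _ => ρ) ∂ρ := by
  -- adapted from `integral_pathWeight_succ_eq` (KernelPathIntegralPeeling)
  set pi : Measure (Fin M → Y) := Measure.pi fun _ => ρ with hpi
  have hmp := (measurePreserving_piFinSuccAbove (fun _ : Fin (M + 1) => ρ) 0).symm
  set G : (Fin (M + 1) → Y) → ℝ := fun ζ =>
    (∏ i : Fin (M + 1), κ (i + s) ((Fin.cons u ζ : Fin (M + 2) → Y) (Fin.castSucc i)) (ζ i)) * F ζ with hG
  have hcons : ∀ (y : Y) (ζ' : Fin M → Y),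
      G (Fin.cons y ζ') = κ s u y * ((∏ i : Fin M,
        κ (i + (s + 1)) ((Fin.cons y ζ' : Fin (M + 1) → Y) (Fin.castSucc i)) (ζ' i)) * F (Fin.cons y ζ')) := by
    intro y ζ'
    rw [hG]
    dsimp only
    rw [Fin.prod_univ_succ]
    simp only [Fin.cons_zero, Fin.cons_succ, Fin.castSucc_zero, ← Fin.succ_castSucc, Fin.val_zero,
      Nat.zero_add, Fin.val_succ]
    have hidx : ∀ i : Fin M, (i : ℕ) + 1 + s = i + (s + 1) := fun i => by omega
    simp only [hidx]
    ring
  have he : ∀ p : Y × (Fin M → Y),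
      (MeasurableEquiv.piFinSuccAbove (fun _ : Fin (M + 1) => Y) 0).symm p = Fin.cons p.1 p.2 := by
    intro p
    simp only [MeasurableEquiv.piFinSuccAbove_symm_apply, Fin.insertNthEquiv, Fin.insertNth_zero,
      Equiv.coe_fn_mk]
    rfl
  have h1 : ∫ ζ, G ζ ∂(Measure.pi fun _ : Fin (M + 1) => ρ) =
      ∫ p, G (Fin.cons p.1 p.2) ∂(ρ.prod pi) := by
    rw [← hmp.integral_comp']
    refine integral_congr_ae (Eventually.of_forall fun p => ?_)
    dsimp only
    rw [he]
  rw [h1]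
  have hcm : Measurable fun p : Y × (Fin M → Y) => (Fin.cons p.1 p.2 : Fin (M + 1) → Y) :=
    measurable_finCons M
  have hGm : Measurable G := by
    have hw := measurable_hetPathWeight hκ s (M + 1)
    exact (hw.comp (measurable_const.prodMk measurable_id)).mul hF
  have hC0 : 0 ≤ C := (norm_nonneg _).trans (hC 0 u u)
  have hB0 : 0 ≤ B := (norm_nonneg _).trans (hFb (Fin.cons u fun _ => u))
  have hGb : ∀ ζ, ‖G ζ‖ ≤ C ^ (M + 1) * B := fun ζ => by
    rw [hG]; dsimp only; rw [norm_mul]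
    exact mul_le_mul (norm_hetPathWeight_le hC s (M + 1) u ζ) (hFb ζ) (norm_nonneg _) (by positivity)
  have hint : Integrable (fun p : Y × (Fin M → Y) => G (Fin.cons p.1 p.2)) (ρ.prod pi) := by
    have hmeas : AEStronglyMeasurable (fun p : Y × (Fin M → Y) => G (Fin.cons p.1 p.2)) (ρ.prod pi) :=
      (hGm.comp hcm).aestronglyMeasurable
    exact memLp_one_iff_integrable.1
      (MemLp.of_bound hmeas (C ^ (M + 1) * B) (Eventually.of_forall fun p => hGb _))
  rw [integral_prod _ hint]
  refine integral_congr_ae (Eventually.of_forall fun y => ?_)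
  dsimp only
  simp_rw [hcons]
  rw [integral_const_mul]

/-- **Peeling `j` sites with bond-dependent kernels: nested integral operators.** For a block of `n + j` sites
with left boundary spin `u`, kernels `κ₀, κ₁, …` on its bonds and an observable `G` of the LAST `n` sites,
`∫ (∏ᵢ κᵢ((u∷ζ)ᵢ, ζᵢ)) G(ζ|_{last n}) dρ^{⊗(n+j)}(ζ) = (op κ₀ (op κ₁ ( ⋯ op κ_{j−1} h)))(u)`, written with
`Fin.foldr`, where `(op κ f)(x) = ∫ κ(x,y) f(y) dρ(y)` and `h(x) = ∫ (∏ᵢ κ_{i+j}((x∷ζ')ᵢ, ζ'ᵢ)) G(ζ') dρ^{⊗n}(ζ')`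
is the same integral over the last `n` sites with boundary spin `x`. [folklore] -/
theorem integral_hetPathWeight_eq_foldr (hκ : ∀ t, Measurable (uncurry (κ t)))
    (hC : ∀ t x y, ‖κ t x y‖ ≤ C) (n : ℕ) {G : (Fin n → Y) → ℝ} (hG : Measurable G) {B : ℝ}
    (hGb : ∀ ζ, ‖G ζ‖ ≤ B) (j : ℕ) :
    ∀ (s : ℕ) (u : Y), ∫ ζ : Fin (n + j) → Y, (∏ i : Fin (n + j),
        κ (i + s) ((Fin.cons u ζ : Fin (n + j + 1) → Y) (Fin.castSucc i)) (ζ i)) * G (fun i => ζ (i.addNat j))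
        ∂(Measure.pi fun _ => ρ) =
      Fin.foldr j (fun i (f : Y → ℝ) => fun x => ∫ y, κ (i + s) x y * f y ∂ρ)
        (fun x => ∫ ζ' : Fin n → Y, (∏ i : Fin n,
          κ (i + (s + j)) ((Fin.cons x ζ' : Fin (n + 1) → Y) (Fin.castSucc i)) (ζ' i)) * G ζ'
          ∂(Measure.pi fun _ => ρ)) u := by
  -- adapted from `integral_pathWeight_eq_iterate` (KernelPathIntegralPeeling)
  induction j with
  | zero =>
    intro s u
    simp only [Fin.foldr_zero, Nat.add_zero]
    rfl
  | succ j ih =>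
    intro s u
    have hFm : Measurable fun ζ : Fin (n + j + 1) → Y => G fun i => ζ (i.addNat (j + 1)) :=
      hG.comp (measurable_pi_lambda _ fun i => measurable_pi_apply _)
    have h1 := integral_hetPathWeight_succ_eq (ρ := ρ) hκ hC s (n + j) u
      (F := fun ζ : Fin (n + j + 1) → Y => G fun i => ζ (i.addNat (j + 1))) hFm (fun ζ => hGb _)
    rw [Fin.foldr_succ]
    refine h1.trans ?_
    simp only [Fin.val_zero, Nat.zero_add]
    refine integral_congr_ae (Eventually.of_forall fun y => ?_)
    dsimp only
    have h2 := ih (s + 1) y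
    have hss : s + 1 + j = s + (j + 1) := by omega
    simp only [hss] at h2
    have hidx : ∀ i : Fin j, (i : ℕ) + (s + 1) = (i.succ : ℕ) + s := fun i => by simp; omega
    simp only [hidx] at h2
    rw [← h2]
    congr 1

/-! ### Cycles -/

omit [MeasurableSpace Y] in
/-- **Cutting the cycle at site `0` (bond-dependent kernels).** For `V = x ∷ ζ` on the cycle of `1 + M + 1`
sites, `∏ₜ κₜ(V t, V (t+1))` is the open path weight `∏ᵢ κᵢ((x ∷ ζ)ᵢ, ζᵢ)` times the closing bond
`κ_{M+1}(ζ_{last}, x)`. [folklore] -/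
theorem prod_cyclic_cons_het (κ : ℕ → Y → Y → ℝ) (M : ℕ) (x : Y) (ζ : Fin (1 + M) → Y) :
    ∏ t : Fin (1 + M + 1), κ (t : ℕ) ((Fin.cons x ζ : Fin (1 + M + 1) → Y) t)
        ((Fin.cons x ζ : Fin (1 + M + 1) → Y) (t + 1)) =
      (∏ i : Fin (1 + M), κ (i : ℕ) ((Fin.cons x ζ : Fin (1 + M + 1) → Y) (Fin.castSucc i)) (ζ i)) *
        κ (M + 1) (ζ ((0 : Fin 1).addNat M)) x := by
  -- adapted from `prod_cyclic_cons` (KernelCyclicPeeling)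
  rw [Fin.prod_univ_castSucc]
  have hlast : (Fin.last (1 + M) : Fin (1 + M + 1)) = ((0 : Fin 1).addNat M).succ :=
    Fin.ext (by simp; omega)
  congr 1
  · refine Finset.prod_congr rfl fun i _ => ?_
    rw [Fin.coeSucc_eq_succ, Fin.cons_succ, Fin.val_castSucc]
  · rw [Fin.last_add_one, Fin.cons_zero, hlast, Fin.cons_succ]
    congr 1
    simp only [Fin.val_succ, Fin.val_addNat, Fin.val_zero]
    omega

/-- **Trace formula for the cycle with bond-dependent kernels.** For bounded measurable kernels `κₜ` on a
finite measure space and the cycle of `1 + M + 1` sites with the periodic weight `∏ₜ κₜ(V t, V (t+1))`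
(the last bond, from site `M + 1` back to site `0`, carries `κ_{M+1}`),
`∫ ∏ₜ κₜ(V t, V (t+1)) dρ^{⊗(M+2)}(V) = ∫ (op κ₀ (op κ₁ (⋯ op κ_M (κ_{M+1}(·, x)))))(x) dρ(x)`
(the path-space form of `Tr(𝕂₀ ⋯ 𝕂_{M+1})`), with `(op κ f)(x) = ∫ κ(x,y) f(y) dρ(y)`. [folklore] -/
theorem integral_cyclic_het_eq_foldr (hκ : ∀ t, Measurable (uncurry (κ t))) (hC : ∀ t x y, ‖κ t x y‖ ≤ C)
    (M : ℕ) :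
    ∫ V : Fin (1 + M + 1) → Y, ∏ t : Fin (1 + M + 1), κ (t : ℕ) (V t) (V (t + 1)) ∂(Measure.pi fun _ => ρ) =
      ∫ x, Fin.foldr (M + 1) (fun i (f : Y → ℝ) => fun w => ∫ y, κ i w y * f y ∂ρ)
        (fun w => κ (M + 1) w x) x ∂ρ := by
  -- Step 1: cut the cycle at site `0`
  have hΦm : Measurable fun V : Fin (1 + M + 1) → Y => ∏ t : Fin (1 + M + 1), κ (t : ℕ) (V t) (V (t + 1)) := by
    refine Finset.measurable_prod _ fun t _ => ?_
    exact (hκ t).comp ((measurable_pi_apply (X := fun _ : Fin (1 + M + 1) => Y) t).prodMk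
      (measurable_pi_apply (X := fun _ : Fin (1 + M + 1) => Y) (t + 1)))
  have hΦb : ∀ V : Fin (1 + M + 1) → Y, ‖∏ t : Fin (1 + M + 1), κ (t : ℕ) (V t) (V (t + 1))‖ ≤
      C ^ (1 + M + 1) := by
    intro V
    calc ‖∏ t : Fin (1 + M + 1), κ (t : ℕ) (V t) (V (t + 1))‖
        ≤ ∏ t : Fin (1 + M + 1), ‖κ (t : ℕ) (V t) (V (t + 1))‖ := Finset.norm_prod_le _ _
      _ ≤ ∏ _t : Fin (1 + M + 1), C := Finset.prod_le_prod (fun t _ => norm_nonneg _) fun t _ => hC _ _ _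
      _ = C ^ (1 + M + 1) := by simp
  rw [integral_pi_succ_eq_integral_cons (ρ := ρ) (1 + M) hΦm hΦb]
  refine integral_congr_ae (Eventually.of_forall fun x => ?_)
  dsimp only
  simp_rw [prod_cyclic_cons_het κ M x]
  -- Step 2: peel the first `M` sites; the last block of one site is `op κ_M (κ_{M+1}(·, x))`
  have hκx : Measurable fun z => κ (M + 1) z x := (hκ _).comp (measurable_id.prodMk measurable_const)
  have hGm : Measurable fun ζ' : Fin 1 → Y => κ (M + 1) (ζ' 0) x := hκx.comp (measurable_pi_apply 0)
  have h := integral_hetPathWeight_eq_foldr (ρ := ρ) hκ hC 1 hGm (B := C) (fun ζ' => hC _ _ _) M 0 x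
  simp only [Nat.add_zero, Nat.zero_add] at h
  rw [h, Fin.foldr_succ_last]
  simp only [Fin.val_castSucc, Fin.val_last]
  -- the one-site block: `∫ ζ' : Fin 1 → Y, κ_M(w, ζ' 0) κ_{M+1}(ζ' 0, x) = ∫ κ_M(w, y) κ_{M+1}(y, x) dρ(y)`
  have hg : (fun w : Y => ∫ ζ' : Fin 1 → Y, (∏ i : Fin 1,
      κ (i + M) ((Fin.cons w ζ' : Fin (1 + 1) → Y) (Fin.castSucc i)) (ζ' i)) * κ (M + 1) (ζ' 0) x
        ∂(Measure.pi fun _ => ρ)) = fun w => ∫ y, κ M w y * κ (M + 1) y x ∂ρ := by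
    funext w
    have hfun : (fun ζ' : Fin 1 → Y => (∏ i : Fin 1,
        κ (i + M) ((Fin.cons w ζ' : Fin (1 + 1) → Y) (Fin.castSucc i)) (ζ' i)) * κ (M + 1) (ζ' 0) x) =
        fun ζ' => κ M w (ζ' 0) * κ (M + 1) (ζ' 0) x := by
      funext ζ'
      simp
    rw [hfun]
    have hmp := measurePreserving_funUnique ρ (Fin 1)
    have h2 := hmp.integral_comp (MeasurableEquiv.funUnique (Fin 1) Y).measurableEmbedding
      (fun y : Y => κ M w y * κ (M + 1) y x)
    rw [← h2]
    rfl
  rw [hg]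

/-! ### Reducing the nested operators: constant stretches and splitting -/

omit [IsFiniteMeasure ρ] in
/-- A stretch of `m` equal kernels contributes the `m`-th iterate of the pointwise operator. [folklore] -/
theorem foldr_op_eq_iterate_of_eq (c : ℕ → Y → Y → ℝ) (K : Y → Y → ℝ) (m : ℕ) :
    ∀ (s : ℕ), (∀ i, i < m → c (i + s) = K) → ∀ g : Y → ℝ,
      Fin.foldr m (fun i (f : Y → ℝ) => fun w => ∫ y, c (i + s) w y * f y ∂ρ) g =
        (fun f : Y → ℝ => fun w => ∫ y, K w y * f y ∂ρ)^[m] g := by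
  induction m with
  | zero => intro s _ g; simp
  | succ m ih =>
    intro s hc g
    rw [Fin.foldr_succ, Function.iterate_succ_apply']
    simp only [Fin.val_zero, Nat.zero_add, Fin.val_succ]
    have hidx : ∀ i : Fin m, (i : ℕ) + 1 + s = i + (s + 1) := fun i => by omega
    simp only [hidx]
    have h0 : c s = K := by simpa using hc 0 (Nat.succ_pos m)
    rw [ih (s + 1) (fun i hi => by rw [show i + (s + 1) = (i + 1) + s by omega]; exact hc (i + 1) (by omega)) g,
      h0]

omit [IsFiniteMeasure ρ] in
/-- `m` equal kernels: the `m`-th iterate of the pointwise operator. [folklore] -/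
theorem foldr_op_const (K : Y → Y → ℝ) (m : ℕ) (g : Y → ℝ) :
    Fin.foldr m (fun (_ : Fin m) (f : Y → ℝ) => fun w => ∫ y, K w y * f y ∂ρ) g =
      (fun f : Y → ℝ => fun w => ∫ y, K w y * f y ∂ρ)^[m] g := by
  have h := foldr_op_eq_iterate_of_eq (ρ := ρ) (fun _ => K) K m 0 (fun _ _ => rfl) g
  simpa using h

/-- Splitting nested operators: the first `n`, then the remaining `m`. [folklore] -/
theorem foldr_add_eq_foldr_foldr {α : Type*} (G : ℕ → α → α) (n m : ℕ) (g : α) :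
    Fin.foldr (n + m) (fun i f => G i f) g = Fin.foldr n (fun i f => G i f) (Fin.foldr m (fun i f => G (i + n) f) g) := by
  induction m generalizing g with
  | zero => simp
  | succ m ih =>
    have lhs : Fin.foldr (n + (m + 1)) (fun i f => G i f) g = Fin.foldr (n + m) (fun i f => G i f) (G (n + m) g) := by
      change Fin.foldr (n + m + 1) (fun i f => G (i : ℕ) f) g = _
      rw [Fin.foldr_succ_last]
      simp only [Fin.val_castSucc, Fin.val_last]
    rw [lhs, Fin.foldr_succ_last]
    simp only [Fin.val_castSucc, Fin.val_last]
    rw [ih, Nat.add_comm m n]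

/-! ### One and two bond insertions in a homogeneous cycle -/

variable {K X X' : Y → Y → ℝ}

/-- **One bond insertion.** A bond kernel `X` (site `0` to site `1`) followed by `1 + M` copies of the transfer
kernel `K` around the cycle of `1 + M + 1` sites:
`∫ X(V 0, V 1) ∏_{t=1}^{M+1} K(V t, V (t+1)) dρ^{⊗(M+2)} = ∫∫ X(x, y) (κ_K^[M] K(·, x))(y) dρ(y) dρ(x)`
(the path-space form of `Tr(𝕏 𝕂^{M+1})`, `(κ_K f)(w) = ∫ K(w,z) f(z) dρ(z)`). [folklore] -/
theorem integral_cyclic_insert_one (hX : Measurable (uncurry X)) (hK : Measurable (uncurry K))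
    (hXb : ∀ x y, ‖X x y‖ ≤ C) (hKb : ∀ x y, ‖K x y‖ ≤ C) (M : ℕ) :
    ∫ V : Fin (1 + M + 1) → Y, X (V 0) (V 1) * ∏ t : Fin (1 + M), K (V t.succ) (V (t.succ + 1))
        ∂(Measure.pi fun _ => ρ) =
      ∫ x, ∫ y, X x y * (fun f : Y → ℝ => fun w => ∫ z, K w z * f z ∂ρ)^[M] (fun z => K z x) y ∂ρ ∂ρ := by
  set κ : ℕ → Y → Y → ℝ := fun t => if t = 0 then X else K with hκ_def
  have hκ0 : κ 0 = X := by simp [hκ_def]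
  have hκs : ∀ t, κ (t + 1) = K := fun t => by simp [hκ_def]
  have hκ : ∀ t, Measurable (uncurry (κ t)) := fun t => by
    rcases t with _ | t
    · rw [hκ0]; exact hX
    · rw [hκs]; exact hK
  have hC : ∀ t x y, ‖κ t x y‖ ≤ C := fun t x y => by
    rcases t with _ | t
    · rw [hκ0]; exact hXb x y
    · rw [hκs]; exact hKb x y
  have hprod : ∀ V : Fin (1 + M + 1) → Y, X (V 0) (V 1) * ∏ t : Fin (1 + M), K (V t.succ) (V (t.succ + 1)) =
      ∏ t : Fin (1 + M + 1), κ (t : ℕ) (V t) (V (t + 1)) := fun V => by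
    rw [Fin.prod_univ_succ]
    simp only [Fin.val_zero, hκ0, Fin.val_succ, hκs, zero_add]
  simp_rw [hprod]
  rw [integral_cyclic_het_eq_foldr (ρ := ρ) hκ hC M]
  refine integral_congr_ae (Eventually.of_forall fun x => ?_)
  dsimp only
  rw [Fin.foldr_succ]
  simp only [Fin.val_zero, Fin.val_succ, hκ0, hκs]
  rw [foldr_op_const (ρ := ρ) K M]

/-- **Two bond insertions.** Bond kernels `X` (site `0 → 1`) and `X'` (site `a+1 → a+2`) separated by `a` copies of
`K` and followed by `b' + 1` copies of `K` around the cycle of `1 + (a + (b'+1)) + 1` sites: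
`∫ ∏ₜ κₜ(V t, V (t+1)) dρ^{⊗} = ∫∫ X(x,y) (κ_K^[a] (z ↦ ∫ X'(z,w) (κ_K^[b'] K(·,x))(w) dρ(w)))(y) dρ(y) dρ(x)`
(the path-space form of `Tr(𝕏 𝕂ᵃ 𝕏' 𝕂^{b'+1})`), where `κₜ = X, K, …, K, X', K, …, K`. [folklore] -/
theorem integral_cyclic_insert_two (hX : Measurable (uncurry X)) (hX' : Measurable (uncurry X'))
    (hK : Measurable (uncurry K)) (hXb : ∀ x y, ‖X x y‖ ≤ C) (hX'b : ∀ x y, ‖X' x y‖ ≤ C)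
    (hKb : ∀ x y, ‖K x y‖ ≤ C) (a b' : ℕ) :
    ∫ V : Fin (1 + (a + (b' + 1)) + 1) → Y, ∏ t : Fin (1 + (a + (b' + 1)) + 1),
        (fun s : ℕ => if s = 0 then X else if s = a + 1 then X' else K) t (V t) (V (t + 1))
        ∂(Measure.pi fun _ => ρ) =
      ∫ x, ∫ y, X x y * (fun f : Y → ℝ => fun w => ∫ z, K w z * f z ∂ρ)^[a]
        (fun z => ∫ w, X' z w * (fun f : Y → ℝ => fun w => ∫ z, K w z * f z ∂ρ)^[b'] (fun v => K v x) w ∂ρ) y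
        ∂ρ ∂ρ := by
  set κ : ℕ → Y → Y → ℝ := fun s => if s = 0 then X else if s = a + 1 then X' else K with hκ_def
  have hκ0 : κ 0 = X := by simp [hκ_def]
  have hκmid : κ (a + 1) = X' := by simp [hκ_def]
  have hκK : ∀ t, t ≠ 0 → t ≠ a + 1 → κ t = K := fun t h0 h1 => by
    simp only [hκ_def]; rw [if_neg h0, if_neg h1]
  have hκ : ∀ t, Measurable (uncurry (κ t)) := fun t => by
    by_cases h0 : t = 0
    · rw [h0, hκ0]; exact hX
    · by_cases h1 : t = a + 1
      · rw [h1, hκmid]; exact hX'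
      · rw [hκK t h0 h1]; exact hK
  have hC : ∀ t x y, ‖κ t x y‖ ≤ C := fun t x y => by
    by_cases h0 : t = 0
    · rw [h0, hκ0]; exact hXb x y
    · by_cases h1 : t = a + 1
      · rw [h1, hκmid]; exact hX'b x y
      · rw [hκK t h0 h1]; exact hKb x y
  rw [integral_cyclic_het_eq_foldr (ρ := ρ) hκ hC (a + (b' + 1))]
  refine integral_congr_ae (Eventually.of_forall fun x => ?_)
  dsimp only
  rw [hκK (a + (b' + 1) + 1) (by omega) (by omega), Fin.foldr_succ]
  simp only [Fin.val_zero, Fin.val_succ, hκ0]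
  -- split the remaining `a + (b'+1)` operators into the first `a` (all `K`) and the last `b' + 1` (`X'`, then `K`)
  rw [foldr_add_eq_foldr_foldr (fun i (f : Y → ℝ) => fun w => ∫ y, κ (i + 1) w y * f y ∂ρ) a (b' + 1)]
  rw [foldr_op_eq_iterate_of_eq (ρ := ρ) κ K a 1 (fun i hi => hκK (i + 1) (by omega) (by omega))]
  congr 1
  funext y
  congr 2
  rw [Fin.foldr_succ]
  simp only [Fin.val_zero, Nat.zero_add, Fin.val_succ, hκmid]
  have h2 := foldr_op_eq_iterate_of_eq (ρ := ρ) (fun t => κ (t + a + 1)) K b' 1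
    (fun i hi => hκK (i + 1 + a + 1) (by omega) (by omega)) (fun v => K v x)
  rw [h2]

/-! ### Merging adjacent bonds (associativity of the transfer operators) -/

section Merge

variable {Y : Type*} [MeasurableSpace Y] {ρ : Measure Y} [IsFiniteMeasure ρ]
  {κ : ℕ → Y → Y → ℝ} {C : ℝ}

/-- The pointwise transfer operator of a bounded measurable kernel preserves measurability and boundedness:
`w ↦ ∫ κ(w,y) g(y) dρ(y)` is measurable and bounded by `C · B · ρ(Y)`. [folklore] -/
theorem measurable_bdd_kernel_op {K : Y → Y → ℝ} (hK : Measurable (uncurry K)) {CK : ℝ} (hCK : ∀ x y, ‖K x y‖ ≤ CK)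
    {g : Y → ℝ} (hg : Measurable g) {B : ℝ} (hgb : ∀ y, ‖g y‖ ≤ B) :
    Measurable (fun w => ∫ y, K w y * g y ∂ρ) ∧ ∀ w, ‖∫ y, K w y * g y ∂ρ‖ ≤ CK * B * ρ.real univ := by
  constructor
  · have hm : Measurable fun p : Y × Y => K p.1 p.2 * g p.2 := hK.mul (hg.comp measurable_snd)
    exact (hm.stronglyMeasurable.integral_prod_right' (ν := ρ)).measurable
  · intro w
    refine norm_integral_le_of_norm_le_const (Eventually.of_forall fun y => ?_)
    rw [norm_mul]
    exact mul_le_mul (hCK w y) (hgb y) (norm_nonneg _) ((norm_nonneg _).trans (hCK w y))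

/-- Iterated transfer operators with bond-dependent kernels preserve measurability and boundedness. [folklore] -/
theorem measurable_bdd_foldr_op (hκ : ∀ t, Measurable (uncurry (κ t))) (hC : ∀ t x y, ‖κ t x y‖ ≤ C)
    {g : Y → ℝ} (hg : Measurable g) {B : ℝ} (hgb : ∀ y, ‖g y‖ ≤ B) :
    ∀ (m s : ℕ), Measurable (Fin.foldr m (fun i (f : Y → ℝ) => fun w => ∫ y, κ (i + s) w y * f y ∂ρ) g) ∧
      ∀ w, ‖Fin.foldr m (fun i (f : Y → ℝ) => fun w => ∫ y, κ (i + s) w y * f y ∂ρ) g w‖ ≤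
        (C * ρ.real univ) ^ m * B := by
  intro m
  induction m with
  | zero => intro s; simpa using ⟨hg, hgb⟩
  | succ m ih =>
    intro s
    rw [Fin.foldr_succ]
    have hshift : (fun (i : Fin m) (f : Y → ℝ) => fun w => ∫ y, κ ((i.succ : ℕ) + s) w y * f y ∂ρ) =
        fun (i : Fin m) (f : Y → ℝ) => fun w => ∫ y, κ (i + (s + 1)) w y * f y ∂ρ := by
      funext i f w
      simp only [Fin.val_succ]
      congr 2
      funext y
      congr 2
      omega
    rw [hshift]
    obtain ⟨hm, hb⟩ := ih (s + 1)
    obtain ⟨hm', hb'⟩ := measurable_bdd_kernel_op (ρ := ρ) (hκ (0 + s)) (hC (0 + s)) hm hb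
    refine ⟨by simpa using hm', fun w => ?_⟩
    have := hb' w
    simp only [Fin.val_zero] at this ⊢
    calc _ ≤ C * ((C * ρ.real univ) ^ m * B) * ρ.real univ := this
      _ = (C * ρ.real univ) ^ (m + 1) * B := by ring

/-- **Fubini for two transfer operators**: `op κ₀ (op κ₁ g) = op (κ₀ ∗ κ₁) g` with
`(κ₀ ∗ κ₁)(w, z) = ∫ κ₀(w,y) κ₁(y,z) dρ(y)`, for bounded measurable kernels and `g`. [folklore] -/
theorem integral_kernel_mul_integral_kernel_mul {K₀ K₁ : Y → Y → ℝ} (hK₀ : Measurable (uncurry K₀))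
    (hK₁ : Measurable (uncurry K₁)) {C₀ C₁ : ℝ} (hC₀ : ∀ x y, ‖K₀ x y‖ ≤ C₀) (hC₁ : ∀ x y, ‖K₁ x y‖ ≤ C₁)
    {g : Y → ℝ} (hg : Measurable g) {B : ℝ} (hgb : ∀ y, ‖g y‖ ≤ B) (w : Y) :
    ∫ y, K₀ w y * ∫ z, K₁ y z * g z ∂ρ ∂ρ = ∫ z, (∫ y, K₀ w y * K₁ y z ∂ρ) * g z ∂ρ := by
  have hint : Integrable (fun p : Y × Y => K₀ w p.1 * (K₁ p.1 p.2 * g p.2)) (ρ.prod ρ) := by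
    have hm : Measurable fun p : Y × Y => K₀ w p.1 * (K₁ p.1 p.2 * g p.2) :=
      ((hK₀.comp (measurable_const.prodMk measurable_fst))).mul (hK₁.mul (hg.comp measurable_snd))
    refine Integrable.of_bound hm.aestronglyMeasurable (C₀ * (C₁ * B)) (Eventually.of_forall fun p => ?_)
    rw [norm_mul, norm_mul]
    have h0 : 0 ≤ C₁ := (norm_nonneg _).trans (hC₁ p.1 p.2)
    exact mul_le_mul (hC₀ _ _) (mul_le_mul (hC₁ _ _) (hgb _) (norm_nonneg _) h0) (by positivity)
      ((norm_nonneg _).trans (hC₀ w p.1))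
  calc ∫ y, K₀ w y * ∫ z, K₁ y z * g z ∂ρ ∂ρ = ∫ y, ∫ z, K₀ w y * (K₁ y z * g z) ∂ρ ∂ρ := by
        refine integral_congr_ae (Eventually.of_forall fun y => ?_)
        exact (integral_const_mul _ _).symm
    _ = ∫ z, ∫ y, K₀ w y * (K₁ y z * g z) ∂ρ ∂ρ := integral_integral_swap hint
    _ = ∫ z, (∫ y, K₀ w y * K₁ y z ∂ρ) * g z ∂ρ := by
        refine integral_congr_ae (Eventually.of_forall fun z => ?_)
        show ∫ y, K₀ w y * (K₁ y z * g z) ∂ρ = (∫ y, K₀ w y * K₁ y z ∂ρ) * g z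
        rw [← integral_mul_const]
        refine integral_congr_ae (Eventually.of_forall fun y => ?_)
        ring

/-- The composed kernel `(κ₀ ∗ κ₁)(w,z) = ∫ κ₀(w,y) κ₁(y,z) dρ(y)` is jointly measurable and bounded. [folklore] -/
theorem measurable_bdd_kernel_conv {K₀ K₁ : Y → Y → ℝ} (hK₀ : Measurable (uncurry K₀))
    (hK₁ : Measurable (uncurry K₁)) {C₀ C₁ : ℝ} (hC₀ : ∀ x y, ‖K₀ x y‖ ≤ C₀) (hC₁ : ∀ x y, ‖K₁ x y‖ ≤ C₁) :
    Measurable (uncurry fun w z => ∫ y, K₀ w y * K₁ y z ∂ρ) ∧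
      ∀ w z, ‖∫ y, K₀ w y * K₁ y z ∂ρ‖ ≤ C₀ * C₁ * ρ.real univ := by
  constructor
  · have hm : Measurable fun p : (Y × Y) × Y => K₀ p.1.1 p.2 * K₁ p.2 p.1.2 :=
      (hK₀.comp ((measurable_fst.comp measurable_fst).prodMk measurable_snd)).mul
        (hK₁.comp (measurable_snd.prodMk (measurable_snd.comp measurable_fst)))
    exact (hm.stronglyMeasurable.integral_prod_right' (ν := ρ)).measurable
  · intro w z
    refine norm_integral_le_of_norm_le_const (Eventually.of_forall fun y => ?_)
    rw [norm_mul]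
    exact mul_le_mul (hC₀ w y) (hC₁ y z) (norm_nonneg _) ((norm_nonneg _).trans (hC₀ w y))

/-- **Merging two adjacent bonds of a heterogeneous cycle.**  On the cycle of `M + 3` sites with kernels `κ₀, κ₁, …`,
integrating out site `1` replaces the two bonds `κ₀, κ₁` by the single bond `κ₀ ∗ κ₁`:
`∫ ∏ₜ κₜ(V t, V (t+1)) dρ^{⊗(M+3)} = ∫ ∏ₜ κ'ₜ(V t, V (t+1)) dρ^{⊗(M+2)}` with `κ'₀ = κ₀ ∗ κ₁`, `κ'ₜ = κ_{t+1}` (`t ≥ 1`)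
(the path-space form of `Tr(𝕂₀𝕂₁𝕂₂⋯) = Tr((𝕂₀𝕂₁)𝕂₂⋯)`; with `integral_cyclic_het_eq_foldr` it is associativity
of the transfer operators, `integral_kernel_mul_integral_kernel_mul`).  Iterating it contracts a slab of consecutive bond
insertions to one bond. [folklore] -/
theorem integral_cyclic_het_merge (hκ : ∀ t, Measurable (uncurry (κ t))) (hC : ∀ t x y, ‖κ t x y‖ ≤ C) (M : ℕ) :
    ∫ V : Fin (1 + (M + 1) + 1) → Y, ∏ t : Fin (1 + (M + 1) + 1), κ (t : ℕ) (V t) (V (t + 1))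
        ∂(Measure.pi fun _ => ρ) =
      ∫ V : Fin (1 + M + 1) → Y, ∏ t : Fin (1 + M + 1),
        (fun s : ℕ => if s = 0 then (fun w z => ∫ y, κ 0 w y * κ 1 y z ∂ρ) else κ (s + 1)) t (V t) (V (t + 1))
        ∂(Measure.pi fun _ => ρ) := by
  set κ' : ℕ → Y → Y → ℝ := fun s => if s = 0 then (fun w z => ∫ y, κ 0 w y * κ 1 y z ∂ρ) else κ (s + 1) with hκ'
  obtain ⟨hconvm, hconvb⟩ := measurable_bdd_kernel_conv (ρ := ρ) (hκ 0) (hκ 1) (hC 0) (hC 1)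
  have hκ'm : ∀ t, Measurable (uncurry (κ' t)) := fun t => by
    by_cases h : t = 0
    · simp only [hκ', h, if_true]; exact hconvm
    · simp only [hκ', h, if_false]; exact hκ _
  set C' : ℝ := max C (C * C * ρ.real univ) with hC'
  have hκ'b : ∀ t x y, ‖κ' t x y‖ ≤ C' := fun t x y => by
    by_cases h : t = 0
    · simp only [hκ', h, if_true]; exact (hconvb x y).trans (le_max_right _ _)
    · simp only [hκ', h, if_false]; exact (hC _ _ _).trans (le_max_left _ _)
  rw [integral_cyclic_het_eq_foldr (ρ := ρ) hκ hC (M + 1), integral_cyclic_het_eq_foldr (ρ := ρ) hκ'm hκ'b M]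
  refine integral_congr_ae (Eventually.of_forall fun x => ?_)
  dsimp only
  -- unfold the first operators on both sides
  rw [Fin.foldr_succ, Fin.foldr_succ, Fin.foldr_succ]
  -- the common inner function
  have hinnerL : (fun (i : Fin M) (f : Y → ℝ) => fun w => ∫ y, κ ((i.succ.succ : Fin (M + 1 + 1)) : ℕ) w y * f y ∂ρ) =
      fun (i : Fin M) (f : Y → ℝ) => fun w => ∫ y, κ (i + 2) w y * f y ∂ρ := by
    funext i f w
    simp only [Fin.val_succ, show (i : ℕ) + 1 + 1 = i + 2 from rfl]
  have hinnerR : (fun (i : Fin M) (f : Y → ℝ) => fun w => ∫ y, κ' ((i.succ : Fin (M + 1)) : ℕ) w y * f y ∂ρ) =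
      fun (i : Fin M) (f : Y → ℝ) => fun w => ∫ y, κ (i + 2) w y * f y ∂ρ := by
    funext i f w
    simp only [Fin.val_succ, hκ', Nat.succ_ne_zero, if_false, show (i : ℕ) + 1 + 1 = i + 2 from rfl]
  have hlastL : (fun w => κ (M + 1 + 1) w x) = fun w => κ (M + 2) w x := rfl
  have hlastR : (fun w => κ' (M + 1) w x) = fun w => κ (M + 2) w x := by
    funext w; simp only [hκ', Nat.succ_ne_zero, if_false, show M + 1 + 1 = M + 2 from rfl]
  rw [hinnerL, hinnerR, hlastL, hlastR]
  set g : Y → ℝ := Fin.foldr M (fun (i : Fin M) (f : Y → ℝ) => fun w => ∫ y, κ (i + 2) w y * f y ∂ρ)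
    (fun w => κ (M + 2) w x) with hg
  obtain ⟨hgm, hgb⟩ := measurable_bdd_foldr_op (ρ := ρ) hκ hC
    ((hκ (M + 2)).comp (measurable_id.prodMk measurable_const)) (fun w => hC (M + 2) w x) M 2
  simp only [Fin.val_zero, Fin.val_succ, hκ', if_true, zero_add]
  exact integral_kernel_mul_integral_kernel_mul (ρ := ρ) (hκ 0) (hκ 1) (hC 0) (hC 1) hgm hgb x

end Merge

/-! ### Block contraction of a slab -/

section Block

variable {Y : Type*} [MeasurableSpace Y] {ρ : Measure Y} [IsFiniteMeasure ρ] {K : Y → Y → ℝ} {C : ℝ}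

/-- Measurability of `(ζ, u) ↦ Fin.snoc ζ u`. [folklore] -/
theorem measurable_finSnoc (M : ℕ) :
    Measurable fun p : (Fin M → Y) × Y => (Fin.snoc p.1 p.2 : Fin (M + 1) → Y) := by
  refine measurable_pi_iff.2 (Fin.lastCases ?_ (fun j => ?_))
  · simp only [Fin.snoc_last]
    exact measurable_snd
  · simp only [Fin.snoc_castSucc]
    exact (measurable_pi_apply j).comp measurable_fst

/-- The measure-preserving splitting of a configuration on `Fin (n + r)` into its first `n` and last `r` coordinates.
[folklore] -/
theorem measurePreserving_finSplit (n r : ℕ) :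
    MeasurePreserving
      (((MeasurableEquiv.piCongrLeft (fun _ : Fin (n + r) => Y) finSumFinEquiv).symm.trans
        (MeasurableEquiv.sumPiEquivProdPi fun _ : Fin n ⊕ Fin r => Y)) :
        (Fin (n + r) → Y) ≃ᵐ (Fin n → Y) × (Fin r → Y))
      (Measure.pi fun _ => ρ) ((Measure.pi fun _ : Fin n => ρ).prod (Measure.pi fun _ : Fin r => ρ)) :=
  (measurePreserving_sumPiEquivProdPi fun _ : Fin n ⊕ Fin r => ρ).comp
    (measurePreserving_piCongrLeft (fun _ : Fin (n + r) => ρ) finSumFinEquiv).symm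

/-- Coordinates of the splitting: the first block. [folklore] -/
theorem finSplit_apply_fst (n r : ℕ) (V : Fin (n + r) → Y) (t : Fin n) :
    (((MeasurableEquiv.piCongrLeft (fun _ : Fin (n + r) => Y) finSumFinEquiv).symm.trans
        (MeasurableEquiv.sumPiEquivProdPi fun _ : Fin n ⊕ Fin r => Y)) V).1 t = V (Fin.castAdd r t) := rfl

/-- Coordinates of the splitting: the second block. [folklore] -/
theorem finSplit_apply_snd (n r : ℕ) (V : Fin (n + r) → Y) (j : Fin r) :
    (((MeasurableEquiv.piCongrLeft (fun _ : Fin (n + r) => Y) finSumFinEquiv).symm.trans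
        (MeasurableEquiv.sumPiEquivProdPi fun _ : Fin n ⊕ Fin r => Y)) V).2 j = V (Fin.natAdd n j) := rfl

/-- **Block contraction of a slab.**  On the cycle of `(1 + M + 1) + r` sites, labelled so that the slab consists of the
sites `castAdd r 0` (start), `natAdd _ 0, …, natAdd _ (r−1)` (interior) and `castAdd r 1` (end), followed by the bonds
`castAdd r 1 → castAdd r 2 → ⋯ → castAdd r (M+1) → castAdd r 0` carrying the kernel `K`, a bounded measurable JOINT weight
`Ψ` of the `r + 2` slab sites integrates out to the single bond kernel `X̂(u,u') = ∫ Ψ(u ∷ v :: u') dρ^{⊗r}(v)` between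
start and end: the cyclic integral equals the one-insertion cyclic integral of `integral_cyclic_insert_one`'s shape
(Fubini over the interior coordinates after the measure-preserving splitting `Fin ((1+M+1)+r) ≃ Fin (1+M+1) ⊕ Fin r`).
[folklore] -/
theorem integral_cyclic_block_contract (hK : Measurable (uncurry K)) (hKb : ∀ x y, ‖K x y‖ ≤ C)
    {r : ℕ} {Ψ : (Fin (r + 2) → Y) → ℝ} (hΨ : Measurable Ψ) {B : ℝ} (hΨb : ∀ z, ‖Ψ z‖ ≤ B) (M : ℕ) :
    ∫ V : Fin ((1 + M + 1) + r) → Y,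
        Ψ (Fin.cons (V (Fin.castAdd r 0))
            (Fin.snoc (fun j : Fin r => V (Fin.natAdd (1 + M + 1) j)) (V (Fin.castAdd r 1)))) *
          ∏ t : Fin (1 + M), K (V (Fin.castAdd r t.succ)) (V (Fin.castAdd r (t.succ + 1)))
        ∂(Measure.pi fun _ => ρ) =
      ∫ W : Fin (1 + M + 1) → Y,
        (∫ v : Fin r → Y, Ψ (Fin.cons (W 0) (Fin.snoc v (W 1))) ∂(Measure.pi fun _ => ρ)) *
          ∏ t : Fin (1 + M), K (W t.succ) (W (t.succ + 1)) ∂(Measure.pi fun _ => ρ) := by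
  set e := ((MeasurableEquiv.piCongrLeft (fun _ : Fin ((1 + M + 1) + r) => Y) finSumFinEquiv).symm.trans
    (MeasurableEquiv.sumPiEquivProdPi fun _ : Fin (1 + M + 1) ⊕ Fin r => Y)) with he_def
  have he : MeasurePreserving e (Measure.pi fun _ => ρ)
      ((Measure.pi fun _ : Fin (1 + M + 1) => ρ).prod (Measure.pi fun _ : Fin r => ρ)) :=
    measurePreserving_finSplit (ρ := ρ) (1 + M + 1) r
  -- the integrand on the product side
  set F : (Fin (1 + M + 1) → Y) × (Fin r → Y) → ℝ := fun p =>
    Ψ (Fin.cons (p.1 0) (Fin.snoc p.2 (p.1 1))) * ∏ t : Fin (1 + M), K (p.1 t.succ) (p.1 (t.succ + 1)) with hF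
  have hFe : ∀ V : Fin ((1 + M + 1) + r) → Y,
      Ψ (Fin.cons (V (Fin.castAdd r 0)) (Fin.snoc (fun j : Fin r => V (Fin.natAdd (1 + M + 1) j)) (V (Fin.castAdd r 1)))) *
          ∏ t : Fin (1 + M), K (V (Fin.castAdd r t.succ)) (V (Fin.castAdd r (t.succ + 1))) = F (e V) :=
    fun V => rfl
  simp_rw [hFe]
  rw [he.integral_comp' (f := e) F]
  -- Fubini
  have hΨm : Measurable fun p : (Fin (1 + M + 1) → Y) × (Fin r → Y) =>
      Ψ (Fin.cons (p.1 0) (Fin.snoc p.2 (p.1 1))) := by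
    refine hΨ.comp ?_
    have h1 : Measurable fun p : (Fin (1 + M + 1) → Y) × (Fin r → Y) => (Fin.snoc p.2 (p.1 1) : Fin (r + 1) → Y) :=
      (measurable_finSnoc r).comp (measurable_snd.prodMk ((measurable_pi_apply 1).comp measurable_fst))
    exact (measurable_finCons (r + 1)).comp (((measurable_pi_apply 0).comp measurable_fst).prodMk h1)
  have hRm : Measurable fun W : Fin (1 + M + 1) → Y => ∏ t : Fin (1 + M), K (W t.succ) (W (t.succ + 1)) := by
    refine Finset.measurable_prod _ fun t _ => ?_
    exact hK.comp (f := fun W : Fin (1 + M + 1) → Y => (W t.succ, W (t.succ + 1)))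
      ((measurable_pi_apply _).prodMk (measurable_pi_apply _))
  have hRb : ∀ W : Fin (1 + M + 1) → Y, ‖∏ t : Fin (1 + M), K (W t.succ) (W (t.succ + 1))‖ ≤ C ^ (1 + M) := fun W =>
    calc ‖∏ t : Fin (1 + M), K (W t.succ) (W (t.succ + 1))‖ ≤ ∏ t : Fin (1 + M), ‖K (W t.succ) (W (t.succ + 1))‖ :=
          Finset.norm_prod_le _ _
      _ ≤ ∏ _t : Fin (1 + M), C := Finset.prod_le_prod (fun _ _ => norm_nonneg _) fun _ _ => hKb _ _
      _ = C ^ (1 + M) := by simp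
  have hFint : Integrable F ((Measure.pi fun _ : Fin (1 + M + 1) => ρ).prod (Measure.pi fun _ : Fin r => ρ)) := by
    refine Integrable.of_bound (hΨm.mul (hRm.comp measurable_fst)).aestronglyMeasurable (B * C ^ (1 + M))
      (Eventually.of_forall fun p => ?_)
    rw [hF]; dsimp only; rw [norm_mul]
    exact mul_le_mul (hΨb _) (hRb _) (norm_nonneg _)
      ((norm_nonneg _).trans (hΨb (Fin.cons (p.1 0) (Fin.snoc p.2 (p.1 1)))))
  rw [integral_prod F hFint]
  refine integral_congr_ae (Eventually.of_forall fun W => ?_)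
  simp only [hF]
  exact integral_mul_const _ _

end Block

/-! ### Relabelling and reversal -/

section Relabel

variable {Y : Type*} [MeasurableSpace Y] {ρ : Measure Y} [IsFiniteMeasure ρ]

/-- **Relabelling invariance of product integrals**: for a permutation `σ` of a finite index set,
`∫ F(V ∘ σ) dρ^{⊗ι}(V) = ∫ F(V) dρ^{⊗ι}(V)`. [folklore] -/
theorem integral_pi_comp_perm {ι : Type*} [Fintype ι] (σ : ι ≃ ι) (F : (ι → Y) → ℝ) :
    ∫ V, F (fun i => V (σ i)) ∂(Measure.pi fun _ : ι => ρ) = ∫ V, F V ∂(Measure.pi fun _ : ι => ρ) := by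
  have h := measurePreserving_piCongrLeft (fun _ : ι => ρ) σ.symm
  have he : ∀ V : ι → Y, (MeasurableEquiv.piCongrLeft (fun _ : ι => Y) σ.symm V) = fun i => V (σ i) := fun V => by
    funext i
    simp only [MeasurableEquiv.coe_piCongrLeft, Equiv.piCongrLeft_apply_eq_cast, cast_eq, Equiv.symm_symm]
  calc ∫ V, F (fun i => V (σ i)) ∂(Measure.pi fun _ : ι => ρ)
        = ∫ V, F (MeasurableEquiv.piCongrLeft (fun _ : ι => Y) σ.symm V) ∂(Measure.pi fun _ : ι => ρ) := by
          simp only [he]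
    _ = ∫ V, F V ∂(Measure.pi fun _ : ι => ρ) := h.integral_comp' F

/-- **The contracted kernel of the reversed slab weight is the transpose**: with `X̂_Ψ(u,u') = ∫ Ψ(u ∷ v :: u') dρ^{⊗r}(v)`,
`X̂_{Ψ ∘ rev}(u, u') = X̂_Ψ(u', u)` (reversal `v ↦ v ∘ rev` preserves `ρ^{⊗r}`, and `rev (u ∷ v :: u') = u' ∷ (v ∘ rev) :: u`) —
the path-space form of "the operator of the time-reflected slab observable is the adjoint". [folklore] -/
theorem integral_block_rev {r : ℕ} (Ψ : (Fin (r + 2) → Y) → ℝ) (u u' : Y) :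
    ∫ v : Fin r → Y, Ψ (fun j => (Fin.cons u (Fin.snoc v u') : Fin (r + 2) → Y) (Fin.rev j)) ∂(Measure.pi fun _ => ρ) =
      ∫ v : Fin r → Y, Ψ (Fin.cons u' (Fin.snoc v u)) ∂(Measure.pi fun _ => ρ) := by
  rw [← integral_pi_comp_perm (ρ := ρ) Fin.revPerm (fun v : Fin r → Y => Ψ (Fin.cons u' (Fin.snoc v u)))]
  refine integral_congr_ae (Eventually.of_forall fun v => ?_)
  dsimp only
  congr 1
  funext j
  -- `(u ∷ v :: u') (rev j) = (u' ∷ (v ∘ rev) :: u) j`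
  refine Fin.cases ?_ (fun i => ?_) j
  · simp only [Fin.rev_zero, Fin.cons_zero]
    show (Fin.cons u (Fin.snoc v u') : Fin (r + 2) → Y) (Fin.last (r + 1)) = u'
    rw [show (Fin.last (r + 1) : Fin (r + 2)) = (Fin.last r).succ from rfl, Fin.cons_succ, Fin.snoc_last]
  · simp only [Fin.cons_succ]
    refine Fin.lastCases ?_ (fun i' => ?_) i
    · simp only [Fin.snoc_last]
      rw [show Fin.rev (Fin.last r).succ = (0 : Fin (r + 2)) by
        ext; simp]
      simp only [Fin.cons_zero]
    · simp only [Fin.snoc_castSucc, Fin.revPerm_apply]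
      rw [show Fin.rev (i'.castSucc.succ : Fin (r + 2)) = (Fin.rev i').castSucc.succ by
        ext; simp [Fin.val_rev]; omega]
      rw [Fin.cons_succ, Fin.snoc_castSucc]

end Relabel

/-! ### Independent blocks of coordinates -/

section Split

/-- **Independent blocks of coordinates**: if `a` depends only on the coordinates in `{i | p i}` and `b` only on the others,
`∫ a(g) b(g) dν^{⊗ι}(g) = (∫ a dν^{⊗p}) (∫ b dν^{⊗¬p})` (`MeasurableEquiv.piEquivPiSubtypeProd` + `integral_prod_mul`).
[folklore] -/
theorem integral_pi_mul_split {ι : Type*} [Fintype ι] (p : ι → Prop) [DecidablePred p] {T : Type*} [MeasurableSpace T]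
    (ν : Measure T) [SigmaFinite ν] (a : ({i // p i} → T) → ℝ) (b : ({i // ¬p i} → T) → ℝ) :
    ∫ g : ι → T, a (fun i => g i) * b (fun i => g i) ∂(Measure.pi fun _ => ν) =
      (∫ x, a x ∂(Measure.pi fun _ => ν)) * ∫ y, b y ∂(Measure.pi fun _ => ν) := by
  have h := measurePreserving_piEquivPiSubtypeProd (fun _ : ι => ν) p
  rw [← integral_prod_mul a b, ← h.integral_comp' (g := fun z => a z.1 * b z.2)]
  rfl

end Split

end Literature.Analysis.OperatorTheory

end
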